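import Mathlib
import Summits.AtomisticToContinuum.HydrodynamicLimit.Theorems.ImplosionDichotomyDenseExcursionSonicSmoothBranchCkCoeff
import Summits.AtomisticToContinuum.HydrodynamicLimit.Theorems.ImplosionDichotomyDenseExcursionSonicSmoothBranchCkPair

/-!
# The Frobenius pair of the characteristic system of a tube profile at the sonic point, uniformly in `Λ`
# (crux `DenseExcursion`, line `sonic-cavity-renewal`, brick for stub `stub_cavityResolventCk`, theorem T2)

Helper file (`--supports stmt-AtomisticToContinuum-12586`, line lead a2, stub-worker W4 for `stub_cavityResolventCk`).
Instantiation of the abstract Frobenius pair (`frobenius_pair_of_series`, file `…SonicSmoothBranchCkPair`) with the power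
series of the characteristic system of a monatomic tube profile at its sonic point (`sonic_coefficient_series`, file
`…SonicSmoothBranchCkCoeff`): for every `k` and every bound `R` there are a radius `ρ ≤ 1` and a constant `C_b` such that
for all `Λ` with `‖Λ‖ ≤ R`, `|Im Λ| ≥ 1` the first-kind singular system
  `x a₁′ = ((Λ − b₊₊)/η) a₁ − (b₊₋/η) a₂`,  `x a₂′ = −(x b₋₊/c₋) a₁ + (x(Λ − b₋₋)/c₋) a₂`   (`c₊ = x η`, `c₋ = W − 1 − S`)
has the analytic Frobenius pair `(a₁, a₂)` (exponent `0`, `a₂(0) = 1`) and `(ψ₁, ψ₂ = x χ)` (exponent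
`ν(Λ) = (b₊₊(0) − Λ)/κ`, `ψ₁(0) = 1`), smooth on `(−ρ, ρ)`, Wronskian within `1/2` of `−1`, with `C^k` bounds `C_b`, and
the two `Λ`-independent inverse speeds `1/η`, `1/c₋` are smooth there with the same bounds (registered helper
`sonic_frobenius_pair`). The uniformity comes from the quantified non-resonance `|Im ν| = |Im Λ|/κ ≥ 4/7` (`κ ≤ 7/4`) and
`‖ν‖ ≤ (5/2)(|b₊₊(0)| + R)` (`κ ≥ 2/5`). Sources: Coddington–Levinson 1955 Ch. 4 (folklore).
-/

noncomputable section

open Set Filter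
open scoped Topology ContDiff

namespace Summit.AtomisticToContinuum.HydrodynamicLimit.Theorems.SonicCavityRenewal

open Summit.AtomisticToContinuum.HydrodynamicLimit.Theorems.R2OneModeTwoConditions

/-- The constant term of a real power series is its value at `0`. [folklore] -/
theorem eq_of_hasSum_at_zero {c : ℕ → ℝ} {v : ℝ} (h : HasSum (fun n => c n * (0 : ℝ) ^ n) v) : c 0 = v := by
  have h2 : HasSum (fun n => c n * (0 : ℝ) ^ n) (c 0 * (0 : ℝ) ^ 0) :=
    hasSum_single 0 fun n hn => by rw [zero_pow hn, mul_zero]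
  rw [pow_zero, mul_one] at h2
  exact h2.unique h

/-- Complexification of a real power series. [folklore] -/
theorem hasSum_ofReal_pow {c : ℕ → ℝ} {v x : ℝ} (h : HasSum (fun n => c n * x ^ n) v) :
    HasSum (fun n => (x : ℂ) ^ n * (c n : ℂ)) (v : ℂ) := by
  have := Complex.ofRealCLM.hasSum h
  simp only [Complex.ofRealCLM_apply, Complex.ofReal_mul, Complex.ofReal_pow] at this
  exact this.congr_fun fun n => by ring

/-- The same, as a series `Σ xⁿ • cₙ` with vector notation (the form of `scalar_series_package`). [folklore] -/
theorem tsum_ofReal_pow_smul {c : ℕ → ℝ} {v x : ℝ} (h : HasSum (fun n => c n * x ^ n) v) :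
    (∑' n, (x : ℂ) ^ n • ((c n : ℝ) : ℂ)) = (v : ℂ) := by
  rw [← (hasSum_ofReal_pow h).tsum_eq]; exact tsum_congr fun n => by rw [smul_eq_mul]

/-- **Registered helper `sonic_frobenius_pair`: THE FROBENIUS PAIR OF THE CHARACTERISTIC SYSTEM OF A TUBE PROFILE AT THE
SONIC POINT, UNIFORMLY IN `Λ`.** See the module docstring. [folklore] -/
theorem sonic_frobenius_pair : ∀ (r : ℝ) (W S : ℝ → ℝ), IsMonatomicProfile r W S → CavityTube r W S → ∀ (k : ℕ) (R : ℝ), ∃ ρ : ℝ, 0 < ρ ∧ ρ ≤ 1 ∧ (∀ x : ℝ, x * dslope (fun y => W y - 1 + S y) 0 x = W x - 1 + S x) ∧ dslope (fun y => W y - 1 + S y) 0 0 = deriv W 0 + deriv S 0 ∧ deriv W 0 + deriv S 0 ≤ -(2 / 5) ∧ -(7 / 4) ≤ deriv W 0 + deriv S 0 ∧ (∀ x ∈ Set.Ioo (-ρ) ρ, dslope (fun y => W y - 1 + S y) 0 x ≠ 0 ∧ W x - 1 - S x < 0) ∧ ∃ Cb : ℝ, 0 ≤ Cb ∧ (∃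 ι₁ ι₂ : ℝ → ℂ, ContDiffOn ℝ ∞ ι₁ (Set.Ioo (-ρ) ρ) ∧ ContDiffOn ℝ ∞ ι₂ (Set.Ioo (-ρ) ρ) ∧ (∀ x ∈ Set.Ioo (-ρ) ρ, ι₁ x = ((1 / dslope (fun y => W y - 1 + S y) 0 x : ℝ) : ℂ) ∧ ι₂ x = ((1 / (W x - 1 - S x) : ℝ) : ℂ)) ∧ ∀ i : ℕ, i ≤ k → ∀ x ∈ Set.Ioo (-ρ) ρ, ‖iteratedDeriv i ι₁ x‖ ≤ Cb ∧ ‖iteratedDeriv i ι₂ x‖ ≤ Cb) ∧ ∀ Λ : ℂ, ‖Λ‖ ≤ R → 1 ≤ |Λ.im| → ∃ (a₁ a₂ ψ₁ ψ₂ χ : ℝ → ℂ), ContDiffOn ℝ ∞ a₁ (Set.Ioo (-ρ) ρ) ∧ ContDiffOn ℝ ∞ a₂ (Set.Ioo (-ρ) ρ) ∧ ContDiffOn ℝ ∞ ψ₁ (Set.Ioo (-ρ) ρ) ∧ ContDiffOn ℝ ∞ ψ₂ (Set.Ioo (-ρ) ρ) ∧ ContDiffOn ℝ ∞ χ (Set.Ioo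 (-ρ) ρ) ∧ a₂ 0 = 1 ∧ ψ₁ 0 = 1 ∧ (∀ x ∈ Set.Ioo (-ρ) ρ, ψ₂ x = (x : ℂ) * χ x) ∧ (∀ x ∈ Set.Ioo (-ρ) ρ, ((x : ℂ) * deriv a₁ x = (Λ - ((2 / 3 * deriv W x + 2 * W x - r + 2 * deriv S x + 4 * S x : ℝ) : ℂ)) / ((dslope (fun y => W y - 1 + S y) 0 x : ℝ) : ℂ) * a₁ x + (-((deriv W x / 3 + deriv S x + 2 * S x : ℝ) : ℂ) / ((dslope (fun y => W y - 1 + S y) 0 x : ℝ) : ℂ)) * a₂ x ∧ (x : ℂ) * deriv a₂ x = (-(x : ℂ) * ((deriv W x / 3 - deriv S x - 2 * S x : ℝ) : ℂ) / ((W x - 1 - S x : ℝ) : ℂ)) * a₁ x + ((x : ℂ) * (Λ - ((2 / 3 * deriv W x + 2 * W x - r - 2 * deriv S x - 4 * S x : ℝ) : ℂ)) / ((W x - 1 - S x : ℝ) : ℂ)) * a₂ x) ∧ ((x : ℂ) * deriv ψ₁ x = ((Λ - ((2 / 3 * deriv W x + 2 * W x - r + 2 * deriv S x + 4 * S x : ℝ)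 : ℂ)) / ((dslope (fun y => W y - 1 + S y) 0 x : ℝ) : ℂ) - ((((2 / 3 * deriv W 0 + 2 * deriv S 0 + 2 * W 0 + 4 * S 0 - r : ℝ) : ℂ) - Λ) / ((-(deriv W 0 + deriv S 0) : ℝ) : ℂ))) * ψ₁ x + (-((deriv W x / 3 + deriv S x + 2 * S x : ℝ) : ℂ) / ((dslope (fun y => W y - 1 + S y) 0 x : ℝ) : ℂ)) * ψ₂ x ∧ (x : ℂ) * deriv ψ₂ x = (-(x : ℂ) * ((deriv W x / 3 - deriv S x - 2 * S x : ℝ) : ℂ) / ((W x - 1 - S x : ℝ) : ℂ)) * ψ₁ x + ((x : ℂ) * (Λ - ((2 / 3 * deriv W x + 2 * W x - r - 2 * deriv S x - 4 * S x : ℝ) : ℂ)) / ((W x - 1 - S x : ℝ) : ℂ) - ((((2 / 3 * deriv W 0 + 2 * deriv S 0 + 2 * W 0 + 4 * S 0 - r : ℝ) : ℂ) - Λ) / ((-(deriv W 0 + deriv S 0) : ℝ) : ℂ))) * ψ₂ x)) ∧ (∀ x ∈ Set.Ioo (-ρ) ρ, ‖a₁ x * ψ₂ x - a₂ x * ψ₁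 x + 1‖ ≤ 1 / 2) ∧ ∀ i : ℕ, i ≤ k → ∀ x ∈ Set.Ioo (-ρ) ρ, ‖iteratedDeriv i a₁ x‖ ≤ Cb ∧ ‖iteratedDeriv i a₂ x‖ ≤ Cb ∧ ‖iteratedDeriv i ψ₁ x‖ ≤ Cb ∧ ‖iteratedDeriv i ψ₂ x‖ ≤ Cb ∧ ‖iteratedDeriv i χ x‖ ≤ Cb := by
  intro r W S hP hT k R
  -- the coefficient series
  obtain ⟨ρ₀, hρ₀, hρ₀1, hxη, hη0, hκ, hκ', hbpm, hne, C₀, θ, e, hC₀, hθ, he, hser⟩ := sonic_coefficient_series r W S hP hT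
  have h0 : (0 : ℝ) ∈ Ioo (-ρ₀) ρ₀ := ⟨by linarith, hρ₀⟩
  obtain ⟨s0, s1, s2, s3, s4, s5, s6⟩ := hser 0 h0
  have e00 := eq_of_hasSum_at_zero s0
  have e10 := eq_of_hasSum_at_zero s1
  have e20 := eq_of_hasSum_at_zero s2
  have e30 := eq_of_hasSum_at_zero s3
  have e40 := eq_of_hasSum_at_zero s4
  have e50 := eq_of_hasSum_at_zero s5
  rw [hη0] at e00 e20 e30
  simp only [zero_mul, zero_div] at e10 e40 e50
  obtain ⟨κ, hκ_def⟩ : ∃ κ : ℝ, κ = -(deriv W 0 + deriv S 0) := ⟨_, rfl⟩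
  have hκpos : 0 < κ := by rw [hκ_def]; linarith
  have hκ25 : 2 / 5 ≤ κ := by rw [hκ_def]; linarith
  have hκle : κ ≤ 7 / 4 := by rw [hκ_def]; linarith
  have hηκ : deriv W 0 + deriv S 0 = -κ := by rw [hκ_def]; ring
  obtain ⟨b₀, hb₀⟩ : ∃ b₀ : ℝ, b₀ = 2 / 3 * deriv W 0 + 2 * deriv S 0 + 2 * W 0 + 4 * S 0 - r := ⟨_, rfl⟩
  -- the constants of the abstract pair theorem
  obtain ⟨ρ₁, hρ₁, Cb₁, hCb₁, hpair⟩ := frobenius_pair_of_series C₀ θ (max R 0) (4 / 7) ((|b₀| + max R 0) * (5 / 2)) (15 / 4) k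
    hC₀ hθ (le_max_right _ _) (by norm_num) (by positivity) (by norm_num)
  -- the packages of the two inverse speeds
  obtain ⟨Cs, hCs0, hCs⟩ := scalar_series_package θ k hθ
  have hce : ∀ i n, ‖((e i n : ℝ) : ℂ)‖ ≤ C₀ * θ ^ n := fun i n => by
    rw [Complex.norm_real, Real.norm_eq_abs]; exact he i n
  obtain ⟨hι₁C, -, hι₁b⟩ := hCs (fun n => ((e 0 n : ℝ) : ℂ)) C₀ (hce 0)
  obtain ⟨hι₂C, -, hι₂b⟩ := hCs (fun n => ((e 6 n : ℝ) : ℂ)) C₀ (hce 6)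
  -- the radius
  obtain ⟨ρ, hρ⟩ : ∃ ρ : ℝ, ρ = min ρ₀ (min ρ₁ (1 / (2 ^ (k + 1) * θ))) := ⟨_, rfl⟩
  have hρpos : 0 < ρ := by rw [hρ]; exact lt_min hρ₀ (lt_min hρ₁ (by positivity))
  have hρρ₀ : ρ ≤ ρ₀ := by rw [hρ]; exact min_le_left _ _
  have hρρ₁ : ρ ≤ ρ₁ := by rw [hρ]; exact (min_le_right _ _).trans (min_le_left _ _)
  have hρθ : ρ ≤ 1 / (2 ^ (k + 1) * θ) := by rw [hρ]; exact (min_le_right _ _).trans (min_le_right _ _)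
  have sub₀ : Ioo (-ρ) ρ ⊆ Ioo (-ρ₀) ρ₀ := fun x hx => ⟨by linarith [hx.1], hx.2.trans_le hρρ₀⟩
  have sub₁ : Ioo (-ρ) ρ ⊆ Ioo (-ρ₁) ρ₁ := fun x hx => ⟨by linarith [hx.1], hx.2.trans_le hρρ₁⟩
  have subθ : Ioo (-ρ) ρ ⊆ Ioo (-(1 / (2 ^ (k + 1) * θ))) (1 / (2 ^ (k + 1) * θ)) :=
    fun x hx => ⟨by linarith [hx.1], hx.2.trans_le hρθ⟩
  have hιeq : ∀ x ∈ Ioo (-ρ) ρ, (∑' n, (x : ℂ) ^ n • ((e 0 n : ℝ) : ℂ)) = ((1 / dslope (fun y => W y - 1 + S y) 0 x : ℝ) : ℂ) ∧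
      (∑' n, (x : ℂ) ^ n • ((e 6 n : ℝ) : ℂ)) = ((1 / (W x - 1 - S x) : ℝ) : ℂ) := fun x hx =>
    ⟨tsum_ofReal_pow_smul (hser x (sub₀ hx)).1, tsum_ofReal_pow_smul (hser x (sub₀ hx)).2.2.2.2.2.2⟩
  refine ⟨ρ, hρpos, hρρ₀.trans hρ₀1, hxη, hη0, hκ, hκ', fun x hx => hne x (sub₀ hx), max Cb₁ (Cs * C₀),
    le_max_of_le_left hCb₁, ⟨fun x => ∑' n, (x : ℂ) ^ n • ((e 0 n : ℝ) : ℂ), fun x => ∑' n, (x : ℂ) ^ n • ((e 6 n : ℝ) : ℂ),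
      hι₁C.mono subθ, hι₂C.mono subθ, hιeq, fun i hi x hx => ⟨(hι₁b i hi x (subθ hx)).trans (le_max_right _ _),
      (hι₂b i hi x (subθ hx)).trans (le_max_right _ _)⟩⟩, fun Λ hΛ hΛi => ?_⟩
  -- the data of the abstract theorem for this `Λ`
  obtain ⟨e', he'⟩ : ∃ e' : Fin 6 → ℕ → ℝ, e' = ![e 0, e 1, e 2, e 3, e 4, e 5] := ⟨_, rfl⟩
  have he'b : ∀ i n, |e' i n| ≤ C₀ * θ ^ n := by
    intro i n; fin_cases i <;> simp [he'] <;> exact he _ n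
  have hE : ∀ n, e' 0 n = e 0 n ∧ e' 1 n = e 1 n ∧ e' 2 n = e 2 n ∧ e' 3 n = e 3 n ∧ e' 4 n = e 4 n ∧ e' 5 n = e 5 n :=
    fun n => by simp [he']
  have hv0 : e' 0 0 = 1 / (-κ) := by simp [he', e00, hηκ]
  have hv2 : e' 2 0 = b₀ / (-κ) := by simp [he', e20, hηκ, hb₀]; ring
  have hv3 : e' 3 0 = (deriv W 0 / 3 + deriv S 0 + 2 * S 0) / (-κ) := by simp [he', e30, hηκ]
  have hv1 : e' 1 0 = 0 := by simp [he', e10]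
  have hv4 : e' 4 0 = 0 := by simp [he', e40]
  have hv5 : e' 5 0 = 0 := by simp [he', e50]
  -- the exponent
  have hκC : ((-κ : ℝ) : ℂ) ≠ 0 := by exact_mod_cast (by linarith : (-κ : ℝ) ≠ 0)
  have hνeq : Λ * (e' 0 0 : ℂ) - (e' 2 0 : ℂ) = (((b₀ : ℝ) : ℂ) - Λ) / ((κ : ℝ) : ℂ) := by
    rw [hv0, hv2]; push_cast; field_simp; ring
  have hνim : |(Λ * (e' 0 0 : ℂ) - (e' 2 0 : ℂ)).im| = |Λ.im| / κ := by
    rw [hνeq, Complex.div_ofReal_im, Complex.sub_im, Complex.ofReal_im, zero_sub, abs_div, abs_neg, abs_of_pos hκpos]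
  have hμ : (4 / 7 : ℝ) ≤ |(Λ * (e' 0 0 : ℂ) - (e' 2 0 : ℂ)).im| := by
    rw [hνim, le_div_iff₀ hκpos]
    calc 4 / 7 * κ ≤ 4 / 7 * (7 / 4) := by gcongr
      _ = 1 := by norm_num
      _ ≤ |Λ.im| := hΛi
  have hνM : ‖Λ * (e' 0 0 : ℂ) - (e' 2 0 : ℂ)‖ ≤ (|b₀| + max R 0) * (5 / 2) := by
    rw [hνeq, norm_div, Complex.norm_real, Real.norm_eq_abs, abs_of_pos hκpos, div_le_iff₀ hκpos]
    calc ‖((b₀ : ℝ) : ℂ) - Λ‖ ≤ ‖((b₀ : ℝ) : ℂ)‖ + ‖Λ‖ := norm_sub_le _ _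
      _ ≤ |b₀| + max R 0 := by rw [Complex.norm_real, Real.norm_eq_abs]; exact add_le_add le_rfl (hΛ.trans (le_max_left _ _))
      _ = (|b₀| + max R 0) * (5 / 2) * (2 / 5) := by ring
      _ ≤ (|b₀| + max R 0) * (5 / 2) * κ := by gcongr
  have hb : |e' 3 0| ≤ 15 / 4 := by
    rw [hv3, abs_div, abs_neg, abs_of_pos hκpos, div_le_iff₀ hκpos]
    calc _ ≤ (3 / 2 : ℝ) := hbpm
      _ = 15 / 4 * (2 / 5) := by norm_num
      _ ≤ 15 / 4 * κ := by gcongr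
  obtain ⟨a₁, a₂, ψ₁, ψ₂, χ, ha₁, ha₂, hψ₁, hψ₂, hχ, ha₂0, hψ₁0, hψχ, hode, hW, hbd⟩ :=
    hpair e' Λ he'b (hΛ.trans (le_max_left _ _)) hμ hνM hb hv1 hv4 hv5
  refine ⟨a₁, a₂, ψ₁, ψ₂, χ, ha₁.mono sub₁, ha₂.mono sub₁, hψ₁.mono sub₁, hψ₂.mono sub₁, hχ.mono sub₁, ha₂0, hψ₁0,
    fun x hx => hψχ x (sub₁ hx), fun x hx => ?_, fun x hx => hW x (sub₁ hx), fun i hi x hx => ?_⟩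
  · -- the equations at `x`: feed the summed coefficients
    obtain ⟨t0, t1, t2, t3, t4, t5, -⟩ := hser x (sub₀ hx)
    have c0 := hasSum_ofReal_pow t0; have c1 := hasSum_ofReal_pow t1; have c2 := hasSum_ofReal_pow t2
    have c3 := hasSum_ofReal_pow t3; have c4 := hasSum_ofReal_pow t4; have c5 := hasSum_ofReal_pow t5
    obtain ⟨hηx, hcmx⟩ := hne x (sub₀ hx)
    have hηC : ((dslope (fun y => W y - 1 + S y) 0 x : ℝ) : ℂ) ≠ 0 := Complex.ofReal_ne_zero.2 hηx
    have hcC : ((W x - 1 - S x : ℝ) : ℂ) ≠ 0 := Complex.ofReal_ne_zero.2 hcmx.ne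
    have m₁₁ : HasSum (fun n => (x : ℂ) ^ n * (Λ * (e' 0 n : ℂ) - (e' 2 n : ℂ)))
        ((Λ - ((2 / 3 * deriv W x + 2 * W x - r + 2 * deriv S x + 4 * S x : ℝ) : ℂ)) /
          ((dslope (fun y => W y - 1 + S y) 0 x : ℝ) : ℂ)) := by
      have h := (c0.mul_left Λ).sub c2
      have hv : Λ * (((1 / dslope (fun y => W y - 1 + S y) 0 x : ℝ)) : ℂ) -
          (((2 / 3 * deriv W x + 2 * W x - r + 2 * deriv S x + 4 * S x) / dslope (fun y => W y - 1 + S y) 0 x : ℝ) : ℂ) =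
          (Λ - ((2 / 3 * deriv W x + 2 * W x - r + 2 * deriv S x + 4 * S x : ℝ) : ℂ)) /
            ((dslope (fun y => W y - 1 + S y) 0 x : ℝ) : ℂ) := by push_cast; ring
      rw [hv] at h
      refine h.congr_fun fun n => ?_
      rw [(hE n).1, (hE n).2.2.1]; ring
    have m₁₂ : HasSum (fun n => (x : ℂ) ^ n * (-(e' 3 n : ℂ)))
        (-((deriv W x / 3 + deriv S x + 2 * S x : ℝ) : ℂ) / ((dslope (fun y => W y - 1 + S y) 0 x : ℝ) : ℂ)) := by
      have h := c3.neg
      have hv : -((((deriv W x / 3 + deriv S x + 2 * S x) / dslope (fun y => W y - 1 + S y) 0 x : ℝ)) : ℂ) =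
          -((deriv W x / 3 + deriv S x + 2 * S x : ℝ) : ℂ) / ((dslope (fun y => W y - 1 + S y) 0 x : ℝ) : ℂ) := by
        push_cast; ring
      rw [hv] at h
      refine h.congr_fun fun n => ?_
      rw [(hE n).2.2.2.1]; ring
    have m₂₁ : HasSum (fun n => (x : ℂ) ^ n * (-(e' 4 n : ℂ)))
        (-(x : ℂ) * ((deriv W x / 3 - deriv S x - 2 * S x : ℝ) : ℂ) / ((W x - 1 - S x : ℝ) : ℂ)) := by
      have h := c4.neg
      have hv : -(((x * (deriv W x / 3 - deriv S x - 2 * S x) / (W x - 1 - S x) : ℝ)) : ℂ) =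
          -(x : ℂ) * ((deriv W x / 3 - deriv S x - 2 * S x : ℝ) : ℂ) / ((W x - 1 - S x : ℝ) : ℂ) := by push_cast; ring
      rw [hv] at h
      refine h.congr_fun fun n => ?_
      rw [(hE n).2.2.2.2.1]; ring
    have m₂₂ : HasSum (fun n => (x : ℂ) ^ n * (Λ * (e' 1 n : ℂ) - (e' 5 n : ℂ)))
        ((x : ℂ) * (Λ - ((2 / 3 * deriv W x + 2 * W x - r - 2 * deriv S x - 4 * S x : ℝ) : ℂ)) / ((W x - 1 - S x : ℝ) : ℂ)) := by
      have h := (c1.mul_left Λ).sub c5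
      have hv : Λ * (((x / (W x - 1 - S x) : ℝ)) : ℂ) -
          (((x * (2 / 3 * deriv W x + 2 * W x - r - 2 * deriv S x - 4 * S x) / (W x - 1 - S x) : ℝ)) : ℂ) =
          (x : ℂ) * (Λ - ((2 / 3 * deriv W x + 2 * W x - r - 2 * deriv S x - 4 * S x : ℝ) : ℂ)) / ((W x - 1 - S x : ℝ) : ℂ) := by
        push_cast; ring
      rw [hv] at h
      refine h.congr_fun fun n => ?_
      rw [(hE n).2.1, (hE n).2.2.2.2.2]; ring
    have hν : Λ * (e' 0 0 : ℂ) - (e' 2 0 : ℂ) = (((b₀ : ℝ) : ℂ) - Λ) / ((-(deriv W 0 + deriv S 0) : ℝ) : ℂ) := by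
      rw [hνeq, hκ_def]
    rw [hb₀] at hν
    obtain ⟨hA, hΨ⟩ := hode x (sub₁ hx) _ _ _ _ m₁₁ m₁₂ m₂₁ m₂₂
    rw [hν] at hΨ
    exact ⟨hA, hΨ⟩
  · obtain ⟨b1, b2, b3, b4, b5⟩ := hbd i hi x (sub₁ hx)
    exact ⟨b1.trans (le_max_left _ _), b2.trans (le_max_left _ _), b3.trans (le_max_left _ _), b4.trans (le_max_left _ _),
      b5.trans (le_max_left _ _)⟩

end Summit.AtomisticToContinuum.HydrodynamicLimit.Theorems.SonicCavityRenewal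

end
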